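import Mathlib
import Summits.ValiantsHypothesis.ValiantsHypothesis.Theses.ValuativeGCT
import Summits.ValiantsHypothesis.ValiantsHypothesis.Theses.GCTMult
import Literature.Computability.AlgebraicComplexity.MultiplicityObstructionsProofs
import Literature.Computability.AlgebraicComplexity.GCTProofs
import Literature.Computability.AlgebraicComplexity.PermanentVsDeterminant
import Literature.NumberTheory.DiophantineGeometry.SchurWeylPlethysmRenameProofs

/-!
# `NoValuativeFlip` (stmt-ValiantsHypothesis-12629): the logical position of the kill statement

Route `ValuativeGCT`, support item `NoValuativeFlip` (the NEGATIVE side / kill statement of the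
route: from some polynomial padding `m ≥ n ^ c₀` on, for every singular-space truncation `(U, r)`
and every `(δ, λ)`, the multiplicity of `λ*` in `ℂ[Δ(X₀₀^(m-n) per_n)]` is at most `dim T_U(λ)`).

This file does not settle the item (an open problem); it records, sorry-free, exactly where it
sits, so that either settlement is recognised for what it is:

* `noValuativeFlip_of_gctNoMultBarrier` — `NoValuativeFlip` follows from the multiplicity no-go
  statement `GCTMult.GctNoMultBarrier` (stmt-0890, `mult_pp ≤ K_m` beyond polynomial padding;
  open, Bläser–Ikenmeyer 2025 §12.4) together with the route's own `ValuativeBound`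
  (`K_m ≤ dim T_U`). Pure logic.
* `not_valuativeFlip_of_noValuativeFlip` — the route's KILL CRITERION made formal: a proof of
  `NoValuativeFlip` refutes the crux `ValuativeFlip`, because the padding `m = n ^ (c₀ + 1)` lies
  in the quasi-polynomial window `n ≤ m ≤ 2 ^ ((log₂ n + c) ^ c)` for `c = c₀ + 2`, `n ≥ 2`.
* `exists_not_hasBorderDetRepr_of_not_noValuativeFlip` — conversely, REFUTING `NoValuativeFlip`
  is summit-hard: with `ValuativeBound`, a failure of the inequality at `(n, m)` is a genuine
  multiplicity obstruction `K_m(λ*) < mult_pp(λ*)`, hence (multiplicity-obstruction principle,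
  discharged in the tree: `orbitMultiplicity_le_of_mem_orbitClosure_holds`,
  `hasBorderDetRepr_iff_rename_holds`) `X₀₀^(m-n) per_n ∉ Δ(det_m)` for some `m ≥ n ^ c` with
  `n` arbitrarily large, for EVERY exponent `c`;
* `dcPerSuperpolynomial_of_not_noValuativeFlip` — and therefore (Valiant universality, padding of
  affine representations and Mulmuley–Sohoni 2001 Prop. 4.4, all discharged in the tree)
  `¬ NoValuativeFlip ∧ ValuativeBound` proves `DcPerSuperpolynomial ℂ`: the determinantal
  complexity of the permanent is not polynomially bounded — Valiant's hypothesis in its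
  permanent-versus-determinant form (Landsberg 2017, Conj. 1.2.4.2), an open conjecture.

Sources: Bürgisser–Landsberg–Manivel–Weyman 2011 (arXiv:0907.2850) §1, §5; Bürgisser–Ikenmeyer–
Panova 2019 (arXiv:1604.06431) §1; Bläser–Ikenmeyer, ToC Graduate Surveys 10 (2025) §12.4;
Mulmuley–Sohoni 2001 §4 (Conj. 4.3, Prop. 4.4).
-/

-- `Summit.ValiantsHypothesis.ValiantsHypothesis.…` repeats a component by the D-0017 layout
-- (single-conjunct summit), which the `dupNamespace` linter flags; the name is mandated.
set_option linter.dupNamespace false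

namespace Summit.ValiantsHypothesis.ValiantsHypothesis.Theorems.NoValuativeFlip

open Literature.NumberTheory.DiophantineGeometry Literature.Computability.AlgebraicComplexity
open Summit.ValiantsHypothesis.ValiantsHypothesis.Theses.ValuativeGCT

/-- **`NoValuativeFlip` from the multiplicity no-go.** If from some polynomial padding on no
highest weight has larger multiplicity in `ℂ[Δ(X₀₀^(m-n) per_n)]` than in `ℂ[Δ(det_m)]`
(`GCTMult.GctNoMultBarrier`, stmt-ValiantsHypothesis-0890) and the valuative bound
`K_m(λ*) ≤ dim T_U(λ)` holds (`ValuativeBound`, stmt-ValiantsHypothesis-12625), then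
`NoValuativeFlip` holds with the same exponent and threshold: `mult_pp(λ*) ≤ K_m(λ*) ≤ dim T_U(λ)`.
Pure logic over the route declarations. -/
theorem noValuativeFlip_of_gctNoMultBarrier
    (hB : Summit.ValiantsHypothesis.ValiantsHypothesis.Theses.GCTMult.GctNoMultBarrier)
    (hVB : ValuativeBound) : NoValuativeFlip := by
  obtain ⟨c₀, n₀, h⟩ := hB
  refine ⟨c₀, n₀, fun n hn m _ hm U r hU δ lam hcard => ?_⟩
  intro χ T
  exact (h n hn m hm χ).trans (hVB m U r hU δ lam hcard)

/-- Window arithmetic: the polynomial padding `n ^ (c₀ + 1)` lies below the top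
`2 ^ ((Nat.log 2 n + (c₀ + 2)) ^ (c₀ + 2))` of the quasi-polynomial window with constant
`c₀ + 2` (every `n`). Indeed `n < 2 ^ (L + 1)` for `L = Nat.log 2 n`, so
`n ^ (c₀ + 1) ≤ 2 ^ ((L + 1) (c₀ + 1))`, and `(L + 1) (c₀ + 1) ≤ (L + c) (L + c) ≤ (L + c) ^ c`
for `c = c₀ + 2 ≥ 2`. [folklore] -/
theorem pow_succ_le_two_pow_log_add_pow (n c₀ : ℕ) :
    n ^ (c₀ + 1) ≤ 2 ^ ((Nat.log 2 n + (c₀ + 2)) ^ (c₀ + 2)) := by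
  set L := Nat.log 2 n with hL
  have hlt : n < 2 ^ (L + 1) := Nat.lt_pow_succ_log_self (by norm_num) n
  have h1 : n ^ (c₀ + 1) ≤ (2 ^ (L + 1)) ^ (c₀ + 1) := Nat.pow_le_pow_left hlt.le _
  have h2 : (L + 1) * (c₀ + 1) ≤ (L + (c₀ + 2)) ^ (c₀ + 2) := by
    calc (L + 1) * (c₀ + 1) ≤ (L + (c₀ + 2)) * (L + (c₀ + 2)) :=
          Nat.mul_le_mul (by omega) (by omega)
      _ = (L + (c₀ + 2)) ^ 2 := by ring
      _ ≤ (L + (c₀ + 2)) ^ (c₀ + 2) := Nat.pow_le_pow_right (by omega) (by omega)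
  calc n ^ (c₀ + 1) ≤ (2 ^ (L + 1)) ^ (c₀ + 1) := h1
    _ = 2 ^ ((L + 1) * (c₀ + 1)) := by rw [← pow_mul]
    _ ≤ 2 ^ ((L + (c₀ + 2)) ^ (c₀ + 2)) := Nat.pow_le_pow_right (by norm_num) h2

/-- **Kill criterion of route `ValuativeGCT`.** `NoValuativeFlip` refutes the crux
`ValuativeFlip`: given the exponent `c₀` and threshold `n₀` of `NoValuativeFlip`, run
`ValuativeFlip` with window constant `c = c₀ + 2`; at `n = max (max n₀ n₁) 2` and the padding
`m = n ^ (c₀ + 1)` (inside the window by `pow_succ_le_two_pow_log_add_pow`, and `≥ n ^ c₀`) the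
flip supplies `(U, r, δ, λ)` with `dim T_U(λ) < mult_pp(λ*)` while `NoValuativeFlip` gives
`mult_pp(λ*) ≤ dim T_U(λ)` for the same data. -/
theorem not_valuativeFlip_of_noValuativeFlip (h : NoValuativeFlip) : ¬ ValuativeFlip := by
  intro hF
  obtain ⟨c₀, n₀, hS⟩ := h
  obtain ⟨n₁, hn₁⟩ := hF (c₀ + 2)
  set n : ℕ := max (max n₀ n₁) 2 with hn
  have hn0 : n₀ ≤ n := (le_max_left _ _).trans (le_max_left _ _)
  have hn1 : n₁ ≤ n := (le_max_right _ _).trans (le_max_left _ _)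
  have hn2 : 2 ≤ n := le_max_right _ _
  haveI : NeZero (n ^ (c₀ + 1)) := ⟨(pow_pos (by omega : 0 < n) _).ne'⟩
  have hnm : n ≤ n ^ (c₀ + 1) := le_self_pow₀ (by omega) (Nat.succ_ne_zero c₀)
  have hwin : n ^ (c₀ + 1) ≤ 2 ^ ((Nat.log 2 n + (c₀ + 2)) ^ (c₀ + 2)) :=
    pow_succ_le_two_pow_log_add_pow n c₀
  have hpad : n ^ c₀ ≤ n ^ (c₀ + 1) := Nat.pow_le_pow_right (by omega) (Nat.le_succ c₀)
  obtain ⟨U, r, δ, lam, hU, hcard, hlt⟩ := hn₁ n hn1 (n ^ (c₀ + 1)) hnm hwin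
  exact (not_le.mpr hlt) (hS n hn0 (n ^ (c₀ + 1)) hpad U r hU δ lam hcard)

/-- **Refuting `NoValuativeFlip` yields border obstructions beyond every polynomial padding.**
Assume the valuative bound `ValuativeBound` (`K_m(λ*) ≤ dim T_U(λ)`). If `NoValuativeFlip` fails,
then for every exponent `c` and threshold `n₀` there are `n ≥ n₀` and a padding `m ≥ n ^ c`,
`m ≥ n`, with `X₀₀^(m-n) per_n ∉ \overline{GL_{m²} · det_m}` (`¬ HasBorderDetRepr ℂ n m`): the
failing data `(U, r, δ, λ)` give `K_m(λ*) ≤ dim T_U(λ) < mult_pp(λ*)`, a multiplicity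
obstruction, and the multiplicity-obstruction principle (BLMW 2011 §1; Bläser–Ikenmeyer 2025
§12.4; tree: `not_hasBorderDetRepr_of_orbitMultiplicity_lt` over the discharged facts
`orbitMultiplicity_le_of_mem_orbitClosure_holds`, `hasBorderDetRepr_iff_rename_holds`) excludes
the padded permanent from the orbit closure. (`NoValuativeFlip` is negated at exponent `c + 1`
and threshold `max n₀ 1`, so that `n ≤ n ^ (c + 1)` and `n ^ c ≤ n ^ (c + 1)`.) -/
theorem exists_not_hasBorderDetRepr_of_not_noValuativeFlip (hVB : ValuativeBound)
    (hS : ¬ NoValuativeFlip) (c n₀ : ℕ) :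
    ∃ n : ℕ, n₀ ≤ n ∧ ∃ (m : ℕ) (_ : NeZero m), n ≤ m ∧ n ^ c ≤ m ∧ ¬ HasBorderDetRepr ℂ n m := by
  by_contra hcon
  apply hS
  refine ⟨c + 1, max n₀ 1, fun n hn m _ hm U r hU δ lam hcard => ?_⟩
  intro χ T
  by_contra hlt
  rw [not_le] at hlt
  apply hcon
  have hn1 : 1 ≤ n := (le_max_right _ _).trans hn
  have hnm : n ≤ m := (le_self_pow₀ hn1 (Nat.succ_ne_zero c)).trans hm
  have hnc : n ^ c ≤ m := (Nat.pow_le_pow_right hn1 (Nat.le_succ c)).trans hm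
  refine ⟨n, (le_max_left _ _).trans hn, m, ‹NeZero m›, hnm, hnc, ?_⟩
  exact not_hasBorderDetRepr_of_orbitMultiplicity_lt orbitMultiplicity_le_of_mem_orbitClosure_holds
    (hasBorderDetRepr_iff_rename_holds (k := ℂ)) hnm ((hVB m U r hU δ lam hcard).trans_lt hlt)

/-- **Refuting `NoValuativeFlip` (given `ValuativeBound`) proves Valiant's hypothesis in
determinantal-complexity form.** If `NoValuativeFlip` fails and `ValuativeBound` holds, then
`dc(per_n)` is not polynomially bounded over `ℂ` (`DcPerSuperpolynomial ℂ`, Landsberg 2017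
Conj. 1.2.4.2 — open). For suppose `dc(per_n) ≤ n ^ c + c` for all `n`. The previous theorem with
exponent `c + 1` gives `n ≥ 2` and `m ≥ n ^ (c + 1) ≥ n ^ c + c ≥ dc(per_n)`, `m ≥ n`, with
`X₀₀^(m-n) per_n ∉ Δ(det_m)`; but the attained representation of size `dc(per_n)`
(`hasDetRepr_determinantalComplexity_holds`, Valiant universality) pads to size `m`
(`HasDetRepr.mono_holds`) and Mulmuley–Sohoni 2001 Prop. 4.4
(`paddedPerPoly_mem_orbitClosure_detPoly_of_hasDetRepr_holds`) puts `X₀₀^(m-n) per_n` inside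
`Δ(det_m)` — contradiction. So the item's refutation is at least as hard as `VBP ≠ VNP` over `ℂ`
(modulo the route's own bound). -/
theorem dcPerSuperpolynomial_of_not_noValuativeFlip (hVB : ValuativeBound)
    (hS : ¬ NoValuativeFlip) : DcPerSuperpolynomial ℂ := by
  rintro ⟨c, hc⟩
  obtain ⟨n, hn2, m, hm, hnm, hncm, hnot⟩ :=
    exists_not_hasBorderDetRepr_of_not_noValuativeFlip hVB hS (c + 1) 2
  apply hnot
  have hd : HasDetRepr (perPoly (Fin n) ℂ) (determinantalComplexity (perPoly (Fin n) ℂ)) :=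
    hasDetRepr_determinantalComplexity_holds _
  have hle : determinantalComplexity (perPoly (Fin n) ℂ) ≤ m :=
    ((hc n).trans (pow_add_self_le_pow_succ hn2 c)).trans hncm
  exact paddedPerPoly_mem_orbitClosure_detPoly_of_hasDetRepr_holds (HasDetRepr.mono_holds hd hle) hnm

/-- **The untruncated content of `NoValuativeFlip`.** Specialising the kill statement to the
trivial centre `U = ⊤`, `r = m` (every `m × m` matrix has rank `≤ m`, and the threshold
`δ (m - m) = 0` makes the valuative factor the unit ideal) shows that `NoValuativeFlip` contains
the `U`-free statement: beyond some polynomial padding, the multiplicity of `λ*` in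
`ℂ[Δ(X₀₀^(m-n) per_n)]` is at most the dimension of the space `T₀(λ)` of `Stab(det_m)`-invariant
highest-weight vectors of weight `λ*` among the forms of degree `m δ` on `End(ℂ^{m × m})` — by
Frobenius reciprocity the multiplicity of `λ` in the coordinate ring `ℂ[GL_{m²} · det_m]` of the
ORBIT (BLMW 2011 §5.2, the symmetric Kronecker count), an upper bound for `K_m(λ)`. This
multiplicity comparison (orbit closure of the padded permanent against the orbit of the
determinant) is not known either way (Bläser–Ikenmeyer 2025 §12.4; BIP 2019 is occurrence-only). -/
theorem orbitMultiplicity_paddedPer_le_finrank_untruncated_of_noValuativeFlip (h : NoValuativeFlip) :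
    ∃ c₀ n₀ : ℕ, ∀ n ≥ n₀, ∀ (m : ℕ) [NeZero m], n ^ c₀ ≤ m →
      ∀ (δ : ℕ) (lam : Nat.Partition (m * δ)), lam.parts.card ≤ m * m →
        let χ : Weight (MatIdx m) := (Weight.dualOfPartition (m * m) lam).toMatIdx
        let T₀ : Submodule ℂ (MvPolynomial (MatIdx m × MatIdx m) ℂ) :=
          MvPolynomial.homogeneousSubmodule (MatIdx m × MatIdx m) ℂ (m * δ) ⊓
            (⨅ (M : Matrix (MatIdx m) (MatIdx m) ℂ)
              (_ : linSubst (MatIdx m) ℂ M (detFormLex ℂ m) = detFormLex ℂ m),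
              LinearMap.ker ((MvPolynomial.aeval (R := ℂ) fun p : MatIdx m × MatIdx m =>
                ∑ l : MatIdx m, M l p.2 • MvPolynomial.X (p.1, l)).toLinearMap -
                LinearMap.id (R := ℂ) (M := MvPolynomial (MatIdx m × MatIdx m) ℂ))) ⊓
            (⨅ (g : Matrix.GeneralLinearGroup (MatIdx m) ℂ) (_ : IsUpperTriangular g),
              LinearMap.ker ((MvPolynomial.aeval (R := ℂ) fun p : MatIdx m × MatIdx m =>
                ∑ l : MatIdx m, ((g⁻¹ : Matrix.GeneralLinearGroup (MatIdx m) ℂ) :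
                  Matrix (MatIdx m) (MatIdx m) ℂ) p.1 l • MvPolynomial.X (l, p.2)).toLinearMap -
                weightChar χ g • LinearMap.id (R := ℂ)
                  (M := MvPolynomial (MatIdx m × MatIdx m) ℂ)))
        orbitMultiplicity ℂ (paddedPerFormLex ℂ n m) m χ ≤ Module.finrank ℂ ↥T₀ := by
  obtain ⟨c₀, n₀, hS⟩ := h
  refine ⟨c₀, n₀, fun n hn m _ hm δ lam hcard => ?_⟩
  have hrank : ∀ u ∈ (⊤ : Submodule ℂ (MatIdx m → ℂ)),
      (Matrix.of fun a b : Fin m => u (toLex (a, b))).rank ≤ m :=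
    fun u _ => Matrix.rank_le_width _
  have key := hS n hn m hm ⊤ m hrank δ lam hcard
  dsimp only at key ⊢
  refine key.trans_eq (congrArg
    (fun S : Submodule ℂ (MvPolynomial (MatIdx m × MatIdx m) ℂ) => Module.finrank ℂ ↥S) ?_)
  rw [Nat.sub_self, mul_zero, pow_zero, Ideal.one_eq_top, Submodule.restrictScalars_top,
    inf_top_eq]

end Summit.ValiantsHypothesis.ValiantsHypothesis.Theorems.NoValuativeFlip
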